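import Literature.MathematicalPhysics.QuantumFieldTheory.Balaban1983to89.Node00.Record12BgRowCoClassCPM

/-!
# NODE 00 — ROW P11 UNDER F7 ∕ v1.5 `CoP`: THE C¹ SENTENCE OF [15] THEOREM 1 — the gauge-invariant READING of (9)–(10) as a NAMED FACT
# `VariationalThm1C1RegSepTop7M F N Sup B₃ B₃' a₀ a₁` ∕ `VariationalThm1C1RegSepCoP7M F N B₃ B₃' a₀ a₁`, its suppliers, and the guard-free row body

Cell `pub-ymgap`, seat `pub-ymgap-node00-def-P11` g4 (R218 ∕ OPS-NOTE-16; pen of record for the [15]-fact leaves).  Plan owner ANSWER-OFFER-2 = GO with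
conditions (a)–(f) (cell bus INBOX l.19007; offer l.18945; g3 successor trigger (t2), dag-lead trigger list l.19091).
[15] = [Balaban1985Variational]; [6] = [Balaban1985RegularSpaces]; [III] = [Balaban1988Convergent]; [I] = [Balaban1987RG1].

WHAT IT IS FOR.  FILE 12d (`Record12BgRowCoClassCPM`) supplies ROW P11's body at node00-def-R's collar-class minimiser `UbgMSCoPOfRecord … s 𝐖` from the GUARDED
named fact `VariationalThm1RegSepCoP7M F N B₃ a₀ a₁` ([15] Thm 1 (8), (R)-reading over class (6) on the support of record) — ★★★ `bgRowAtDatumCoP_of_thm1RegSepCoP7MC1`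
(Record12BgRowCoClassCPM.lean:237) — modulo ONE DISPLAYED raw clause, the C¹ class hypothesis
`hclassC1 : W ∈ solvableDom … → ∀ n, 1 ≤ n → n ≤ k → PlaqC1SmallOn (plaqInside (s.Ω n)) (B₃'·(cR·ε_n)·η_n³) (UbgMSCoPOfRecord … s W)`,
which carries the CONTENT of [15] Thm 1 (9)–(10) p. 279 (FILE 7a's gauge-invariant predicate `PlaqC1SmallOn`: adjacent plaquette variables, transported along the
joining bond, differ by `< δ` in `dist1`; it is what the comb-gauge gradient lemma `norm_grad_axialPotential_le` consumes to produce the derivative members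
`h3I`∕`h3MS` of (1.12) [I] ∕ (2.38) [III]).  THIS FILE names that content as a located [15] sentence — so that K0⁵'s Cut B reads «conditional on two CITED [15]
sentences ((8) and (9)–(10)) + proved glue» instead of «(8) cited + a displayed raw clause» (plan: the counting unit is a NAMED, LOCATED Bałaban sentence;
same logical status, the debt is named and tracked) — and discharges `hclassC1` from it.

THE SENTENCE (§1, §3).  ★★ `VariationalThm1C1RegSepTop7M F N Sup B₃ B₃' a₀ a₁` := FILE 12d's `VariationalThm1RegSepTop7M F N Sup B₃ a₀ a₁` binder block
BYTE FOR BYTE (condition (b): separated `s`, `0 < ν.M₁` right after `Sect2.SeqSeparated ν.M₁ s →`, `0 < δ_n ≤ a₁ ∧ B₃δ_n ≤ ε₀`, `δ_n ≤ 2δ_{n+1}` and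
`δ_{n+1} ≤ 2δ_n`, `ε₀ ≤ a₀`, print's (7) on the datum over the support `Sect2.DataSmall7PTop`, EVERY minimiser `U₀` over the top-domain class (6) at `ε₀`) with
ONLY the conclusion replaced by `∀ n, 1 ≤ n → n ≤ k → PlaqC1SmallOn (plaqInside (s.Ω n)) (B₃' * δ n * η_n ^ 3) U₀` (condition (c): plaquette pairs INSIDE `Ω_n`,
scales `1 ≤ n ≤ k` — all their bonds are free, so no pinned-data instance of the LOCATED-P11 kind exists); ★★ `VariationalThm1C1RegSepCoP7M F N B₃ B₃' a₀ a₁` := it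
at `Sup := suppDomOfRecord` (definitional, v1.5 `CoP` selector of record).  ONE DELTA against the offer's displayed arity (`Sup B₃' a₀ a₁` ↦ `Sup B₃ B₃' a₀ a₁`):
the binder keeps print's STANDING RANGE «ε₁ ≤ a₁, B₃ε₁ ≤ ε₀ ≤ a₀» with the (8)∕uniqueness constant `B₃` ([15] p. 279, Thm 1 and the first paragraph of Sect. A:
«We assume that ε₁ ≤ a₁, B₃ε₁ ≤ ε₀ ≤ a₀»), so that (b) holds literally and the composite below needs NO numerics letter beyond 12d's (`hnum` already carries
`B₃·(cR·ε_n) ≤ εreg`); `B₃'` is the (9)–(10) constant only.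

HONEST LABEL (condition (a)).  The conclusion is a GAUGE-INVARIANT READING, IN CONSEQUENCE FORM, of [15] Thm 1 (9)–(10) p. 279 — NOT verbatim.  Print: for every
cube `□` of the class of pp. 278–279 (size `2ML^jη`, `M` a multiple of `R₁M₁`, `M ≤ M(ε₁) = R₁M₁(a₁∕ε₁)`; the concentric cube of size `(2M + 4R₁M₁)L^jη` lies in
`B_j(Λ_j) ∪ B_{j+1}(Λ_{j+1}) = Ω_j ∖ Ω_{j+2}` but not in `B_{j+1}(Λ_{j+1})`) there is a gauge `u` on a neighbourhood of `□` with, on `□`, `U^u = e^{iηA}`,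
`|A| < B₃Mε₁(L^jη)⁻¹`, `|∇^ηA| < B₃Mε₁(L^jη)⁻²`, `|∇^ηA|_{β,□} < B₄(β₀)Mε₁(L^jη)^{−2−β}` for `0 ≤ β ≤ β₀` (9), `|∂^{η*}∂^ηA|, |Δ^ηA| < B₃Mε₁(L^jη)⁻³` (10);
«a₀, a₁, B₃ depend on d and L only, the constants B₄(β₀), M(ε₁) depend on the indicated parameters also».  Reading: in the gauge of (9) the lattice field strength is
`O(ε₁(L^jη)⁻²)` with covariant lattice derivative `O(ε₁(L^jη)⁻³)` on the class cubes, i.e. the plaquette variable at `p + e_ν` transported back along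
`⟨p.src, p.src + e_ν⟩` differs from the one at `p` by `O(ε₁·η³(L^jη)⁻³) = O(ε₁·η_j³)` in `dist1` (`η_j = (F.P K).eta j = L^{−j}`); NAMED ABSORPTIONS into `B₃'`:
`B₃·M` at the cube sizes of record, `B₄(β₀)`, the quadratic commutator term of the covariant difference (`‖[X, Y]‖ ≤ 2‖X − 1‖‖Y − 1‖`, FILE 7a (D1)), and the
one-scale factor `≤ 2L³` for pairs in the collar of `Ω_n` covered only by scale-`(n−1)` class cubes (two-sided comparability `δ_{n−1} ≤ 2δ_n`; deeper pairs, inside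
`Ω_{n'}`, `n' > n`, dominate by `δ_{n'}η_{n'}³ ≤ δ_nη_n³`).  The facts are `Prop`s with parameters, NEVER asserted here; orbit uniqueness is not part of them.

CONTENTS.  §1 ★★ `VariationalThm1C1RegSepTop7M` (def), `.of_le` (antitone in `a₀`, `a₁`), `.mono` (monotone in `B₃'`); §2 suppliers generic in the minimiser and
in `Sup`: `plaqC1SmallOn_of_thm1C1RegSepTop7M`, ★★★ `bgRowAtDatumU_of_thm1RegSepTop7M_of_thm1C1` (= 12d `bgRowAtDatumU_of_thm1RegSepTop7MC1` with `hclassC1`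
DISCHARGED by the C¹ fact); §3 ★★ `VariationalThm1C1RegSepCoP7M` (def), `.toTop7M` ∕ `VariationalThm1C1RegSepTop7M.toCoP7M` (definitional), `.of_le`, `.mono`,
★ `plaqC1SmallOn_UbgMSCoPOfRecord_of_thm1C1RegSepCoP7M` (= EXACTLY 12d ★★★'s `hclassC1` clause on the solvable set), ★★★
`bgRowAtDatumCoP_of_thm1RegSepCoP7M_of_thm1C1` — ROW P11's body at `(s, 𝐖)` for `UbgMSCoPOfRecord … s 𝐖` from the TWO cited sentences, no displayed C¹ guard.

HONEST FRAMING.  Statement architecture + bookkeeping around TWO NAMED FACTS (`Prop`s, NEVER asserted); nothing of Bałaban asserted or discharged; K0⁵ NOT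
closed; counts unmoved (typed 28∕28 · discharged 5∕28); one finite `𝕋⁴` torus family at fixed `ε = L^{−K}`; not continuum ∕ OS ∕ mass gap ∕ Clay.  Two `def`s,
no `instance`, no `sorry`.  Conditions (d)–(f): new leaf, nothing landed edited; no K text ∕ route key ∕ V10 stub signature touched; node00-def-K0a's 16c
(keyed on 12d's displayed guard) unaffected — the composite is an optional one-token re-key.

DEPENDENCES (by name): FILE 12d `Node00.Record12BgRowCoClassCPM` (`VariationalThm1RegSepTop7M`, `VariationalThm1RegSepCoP7M`, `bgRowAtDatumU_of_thm1RegSepTop7MC1`,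
`bgRowAtDatumCoP_of_thm1RegSepCoP7MC1`), FILE 12a `Node00.Record12BgRowTopDomain` (`Sect2.omegaPlaqsTop`, `Sect2.CoDivClassOnTop`, `Sect2.DataSmall7PTop`),
FILE 7a `Node00.Record12BgRowGaugeGradient` (`PlaqC1SmallOn`, `.of_le`), node00-def-R FILE 22′ `Node00.LargeFieldBackgroundCoPOfRecord` (`suppDomOfRecord`,
`regMSCoPOfRecord`, `UbgMSCoPOfRecord`, `isMinimizer_UbgMSCoPOfRecord`), `Node00.SmallFieldChiOfRecord.plaqInside`, r11 `IsMinimizer`, `avOfRecord`, `genSet`,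
`epsOfRecord`, FILE 2 `Sect2.SeqSeparated`.
-/

noncomputable section

open MeasureTheory
open scoped Matrix.Norms.L2Operator

namespace Literature.MathematicalPhysics.QuantumFieldTheory.Balaban1983to89.Node00

open T4Continuum B14.Eq218Concrete B15DeterminingSets B12RegularSpaces111 B14RegularSpaces234 B14Radii T4AxialGaugeSmallField

/-! ## §1  The C¹ sentence of [15] Theorem 1 over the top-domain class (6), guarded edition (`M₁ ≥ 1`) -/

section NamedFactC1TopM

variable (F : T4Family) (N : ℕ) [NeZero N]

/-- **★★ NAMED FACT — [15] THEOREM 1 (9)–(10), GAUGE-INVARIANT C¹ READING (CONSEQUENCE FORM), OVER PRINT'S CLASS (6) OF CONFIGURATIONS ON THE SUPPORT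
`Ω₀ = Sup ν K s.Ω`, THRESHOLDS COMPARABLE BOTH WAYS, AT NUMERICS WITH `M₁ ≥ 1`** (a `Prop` with parameters, NEVER asserted): FILE 12d's `VariationalThm1RegSepTop7M
F N Sup B₃ a₀ a₁` binder block byte for byte — separated `s`, `0 < ν.M₁`, `0 < δ_n ≤ a₁`, `B₃δ_n ≤ ε₀ ≤ a₀` (print's standing range «ε₁ ≤ a₁, B₃ε₁ ≤ ε₀ ≤ a₀» with
the (8)∕uniqueness constant `B₃`), `δ_n ≤ 2δ_{n+1}` and `δ_{n+1} ≤ 2δ_n`, datum with (7) on the support (`Sect2.DataSmall7PTop`), EVERY minimiser `U₀` over the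
top-domain class (6) at `ε₀` — with the conclusion: at every scale `1 ≤ n ≤ k`, for every pair of adjacent plaquettes INSIDE `Ω_n` (`plaqInside`), the plaquette
variable of `U₀` at `p + e_ν` transported back along `⟨p.src, p.src + e_ν⟩` differs from the one at `p` by `< B₃'·δ_n·η_n³` in `dist1` (FILE 7a's `PlaqC1SmallOn`).
HONEST LABEL: this conclusion is a gauge-invariant READING, in consequence form, of print's (9)–(10) p. 279 — on every cube `□` of the class of pp. 278–279 (size
`2ML^jη`, `M ≤ M(ε₁) = R₁M₁(a₁∕ε₁)`) a gauge `u` with `U^u = e^{iηA}`, `|A| < B₃Mε₁(L^jη)⁻¹`, `|∇^ηA| < B₃Mε₁(L^jη)⁻²`, `|∇^ηA|_{β,□} < B₄(β₀)Mε₁(L^jη)^{−2−β}`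
(9), `|∂^{η*}∂^ηA|, |Δ^ηA| < B₃Mε₁(L^jη)⁻³` (10) — NOT verbatim; `B₃'` ABSORBS `B₃·M` at the cube sizes of record, `B₄(β₀)`, the quadratic commutator term of the
covariant difference, and the one-scale factor `≤ 2L³` for pairs in the collar of `Ω_n` covered only by scale-`(n−1)` class cubes (module docstring).
Inhabitation floor displayed by consumers for the companion (8)-sentence: `2L² ≤ B₃`; expected floor here (print: «positive constants»): `0 < B₃'` — at `B₃' ≤ 0` the
conclusion fails as soon as a minimiser exists and `Ω_n` holds one adjacent plaquette pair (`dist1 ≥ 0`); consumers take `0 ≤ B₃'`.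
-- TODO(general form): print states (9)–(10) in an axial-type gauge on the class cubes with Hölder member `B₄(β₀)` and ONE threshold ε₁; general admissible
-- `{Ω_j}`∕`𝔅_k` ([6] Sect. A) and print's separation letter `R ≥ R₁`; orbit uniqueness is not part of this sentence.
[cite: Balaban1985Variational, (1) p.277, Thm 1 (2),(3),(5),(6),(7),(9)–(10) pp.278–279; Balaban1985RegularSpaces, (1.3)–(1.9) p.77; Balaban1988Convergent, p.255, (2.6)–(2.8) pp.255–256, (2.12) p.256, (2.38) p.261] -/
def VariationalThm1C1RegSepTop7M (Sup : (ν : Stage7Numerics) → (K : ℕ) → (ℕ → Set (Site (F.P K) 0)) → Set (Site (F.P K) 0)) (B₃ B₃' a₀ a₁ : ℝ) : Prop :=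
  ∀ (ν : Stage7Numerics) (M : ℕ) (g : ℕ → ℝ) (K k : ℕ) (s : SeqOfRecord F ν M g K k), Sect2.SeqSeparated ν.M₁ s → 0 < ν.M₁ → ∀ (ε₀ : ℝ) (δ : ℕ → ℝ),
    (∀ n, n ≤ k → 0 < δ n ∧ δ n ≤ a₁ ∧ B₃ * δ n ≤ ε₀) → (∀ n, n < k → δ n ≤ 2 * δ (n + 1)) → (∀ n, n < k → δ (n + 1) ≤ 2 * δ n) → ε₀ ≤ a₀ →
    ∀ W : MSField (F.P K) (SU N), Sect2.DataSmall7PTop (avOfRecord F N K) s.Ω (Sup ν K s.Ω) k δ W →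
      ∀ U₀, IsMinimizer (avOfRecord F N K)
          {U | (∀ n, n ≤ k → PlaqSmallOn (Sect2.omegaPlaqsTop s.Ω (Sup ν K s.Ω) n) (ε₀ * (F.P K).eta n ^ 2) U) ∧
            Sect2.CoDivClassOnTop s.Ω (Sup ν K s.Ω) k ε₀ U} (genSet s.Ω k) W U₀ →
        ∀ n, 1 ≤ n → n ≤ k → PlaqC1SmallOn (plaqInside (s.Ω n)) (B₃' * δ n * (F.P K).eta n ^ 3) U₀

variable {F N}

/-- The C¹ top-domain sentence is ANTITONE in `a₀`, `a₁`. [cite: Balaban1985Variational, Thm 1 p.279 (the range «ε₀ ≤ a₀», «ε₁ ≤ a₁»)] -/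
theorem VariationalThm1C1RegSepTop7M.of_le {Sup : (ν : Stage7Numerics) → (K : ℕ) → (ℕ → Set (Site (F.P K) 0)) → Set (Site (F.P K) 0)} {B₃ B₃' a₀ a₀' a₁ a₁' : ℝ}
    (h : VariationalThm1C1RegSepTop7M F N Sup B₃ B₃' a₀ a₁) (ha₀ : a₀' ≤ a₀) (ha₁ : a₁' ≤ a₁) : VariationalThm1C1RegSepTop7M F N Sup B₃ B₃' a₀' a₁' :=
  fun ν M g K k s hsep hM₁ ε₀ δ hnum hcomp hcomp' hε W h7 U₀ hmin =>
    h ν M g K k s hsep hM₁ ε₀ δ (fun n hn => ⟨(hnum n hn).1, (hnum n hn).2.1.trans ha₁, (hnum n hn).2.2⟩) hcomp hcomp' (hε.trans ha₀) W h7 U₀ hmin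

/-- The C¹ top-domain sentence is MONOTONE in the C¹ constant `B₃'` (a larger constant is a weaker conclusion). [cite: Balaban1985Variational, Thm 1 (9)–(10) p.279 (bookkeeping)] -/
theorem VariationalThm1C1RegSepTop7M.mono {Sup : (ν : Stage7Numerics) → (K : ℕ) → (ℕ → Set (Site (F.P K) 0)) → Set (Site (F.P K) 0)} {B₃ B₃' B₃'' a₀ a₁ : ℝ}
    (h : VariationalThm1C1RegSepTop7M F N Sup B₃ B₃' a₀ a₁) (hB : B₃' ≤ B₃'') : VariationalThm1C1RegSepTop7M F N Sup B₃ B₃'' a₀ a₁ :=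
  fun ν M g K k s hsep hM₁ ε₀ δ hnum hcomp hcomp' hε W h7 U₀ hmin n hn1 hnk =>
    (h ν M g K k s hsep hM₁ ε₀ δ hnum hcomp hcomp' hε W h7 U₀ hmin n hn1 hnk).of_le
      (mul_le_mul_of_nonneg_right (mul_le_mul_of_nonneg_right hB (hnum n hnk).1.le)
        (pow_nonneg (by unfold Params.eta; positivity) 3))

end NamedFactC1TopM

/-! ## §2  Suppliers GENERIC IN THE MINIMISER over the top-domain class (6) (12d §2's binder lists, `(hM₁ : 0 < ν.M₁)` right after `hsep`) -/

section SuppliersC1TopM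

variable {F : T4Family} {N : ℕ} [NeZero N]

/-- **★ EVERY MINIMISER OVER THE TOP-DOMAIN CLASS (6) AT THE RECORD'S LETTERS MEETS THE C¹ CLASS BOUND `B₃'·cR·ε_n·η_n³` ON THE PLAQUETTE PAIRS INSIDE `Ω_n`,
`1 ≤ n ≤ k`**, for a separated sequence, numerics with `M₁ ≥ 1`, thresholds comparable both ways and a datum with print's (7) on the support, from the C¹ sentence;
`εreg` generic.  (The gauge-invariant reading of [15] Thm 1 (9)–(10); §1 docstring.) [cite: Balaban1985Variational, Thm 1 (2),(6),(7),(9)–(10) pp.278–279; Balaban1985RegularSpaces, (1.3) p.77; Balaban1988Convergent, (2.6)–(2.8) pp.255–256, (2.12) p.256] -/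
theorem plaqC1SmallOn_of_thm1C1RegSepTop7M {Sup : (ν : Stage7Numerics) → (K : ℕ) → (ℕ → Set (Site (F.P K) 0)) → Set (Site (F.P K) 0)} {B₃ B₃' a₀ a₁ : ℝ}
    (h15C1 : VariationalThm1C1RegSepTop7M F N Sup B₃ B₃' a₀ a₁) (ν : Stage7Numerics) (M : ℕ)
    (g : ℕ → ℝ) (K k : ℕ) (cR : ℝ) (s : SeqOfRecord F ν M g K k) (hsep : Sect2.SeqSeparated ν.M₁ s) (hM₁ : 0 < ν.M₁)
    (hnum : ∀ n, n ≤ k → 0 < cR * epsOfRecord ν g n ∧ cR * epsOfRecord ν g n ≤ a₁ ∧ B₃ * (cR * epsOfRecord ν g n) ≤ ν.εreg) (ha₀ : ν.εreg ≤ a₀)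
    (hcomp : ∀ n, n < k → cR * epsOfRecord ν g n ≤ 2 * (cR * epsOfRecord ν g (n + 1)))
    (hcomp' : ∀ n, n < k → cR * epsOfRecord ν g (n + 1) ≤ 2 * (cR * epsOfRecord ν g n))
    {W : MSField (F.P K) (SU N)} (h7 : Sect2.DataSmall7PTop (avOfRecord F N K) s.Ω (Sup ν K s.Ω) k (fun n => cR * epsOfRecord ν g n) W)
    {U₀ : GaugeField (F.P K) 0 (SU N)} (hmin : IsMinimizer (avOfRecord F N K)
      {U | (∀ n, n ≤ k → PlaqSmallOn (Sect2.omegaPlaqsTop s.Ω (Sup ν K s.Ω) n) (ν.εreg * (F.P K).eta n ^ 2) U) ∧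
        Sect2.CoDivClassOnTop s.Ω (Sup ν K s.Ω) k ν.εreg U} (genSet s.Ω k) W U₀) :
    ∀ n, 1 ≤ n → n ≤ k → PlaqC1SmallOn (plaqInside (s.Ω n)) (B₃' * (cR * epsOfRecord ν g n) * (F.P K).eta n ^ 3) U₀ :=
  h15C1 ν M g K k s hsep hM₁ ν.εreg (fun n => cR * epsOfRecord ν g n) hnum hcomp hcomp' ha₀ W h7 U₀ hmin

/-- **★★★ ROW P11's BODY AT `(s, 𝐖)` FOR EVERY MINIMISER `U₀` OVER THE TOP-DOMAIN CLASS (6), FROM THE TWO [15] SENTENCES — (8) `VariationalThm1RegSepTop7M` AND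
(9)–(10) `VariationalThm1C1RegSepTop7M` — WITH NO DISPLAYED C¹ GUARD**: FILE 12d's `bgRowAtDatumU_of_thm1RegSepTop7MC1` binder for binder, its hypothesis
`hclassC1` DISCHARGED by `plaqC1SmallOn_of_thm1C1RegSepTop7M`.  Hypotheses: the two sentences, print's (7) on the datum over the support (`h7`), numerics incl.
FILE 7c's two «C₀ large» letters, (C1)(C2), no wrapping, `hcomp` AND `hcomp'`, `hM₁`.  NO `h9`, NO `hclassC1`.
[cite: Balaban1985Variational, Thm 1 (2),(6)–(10) pp.278–279; Balaban1985RegularSpaces, (1.3)–(1.9) p.77; Balaban1988Convergent, (2.4)–(2.8) pp.255–256, (2.12) p.256, (2.27)–(2.28) p.259, (2.34)–(2.41) p.261; Balaban1987RG1, (1.11)–(1.16) p.262] -/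
theorem bgRowAtDatumU_of_thm1RegSepTop7M_of_thm1C1 {Sup : (ν : Stage7Numerics) → (K : ℕ) → (ℕ → Set (Site (F.P K) 0)) → Set (Site (F.P K) 0)}
    {B₃ B₃' a₀ a₁ tI tMS : ℝ}
    (h15 : VariationalThm1RegSepTop7M F N Sup B₃ a₀ a₁) (h15C1 : VariationalThm1C1RegSepTop7M F N Sup B₃ B₃' a₀ a₁)
    (S : Sect2.Setting (MatA N) (SU N)) (hι : S.ι = ιSU N) (h𝓜 : S.𝓜 = B12RegularSpaces111SpecialUnitary.suModel N) (hS : S.Laws) (hpos : S.Pos)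
    (ν : Stage7Numerics) {M : ℕ} (hM : 0 < M) (K k : ℕ) (cR : ℝ) (hB₃ : 0 ≤ B₃) (hB₃' : 0 ≤ B₃')
    (hg : ∀ j, 1 ≤ j → j ≤ k → 0 < S.flow.g j ∧ S.flow.g j ^ 2 ≤ Real.exp (-1)) (hpq : ν.p₀ ≤ S.lf.q₀)
    (hnum : ∀ n, n ≤ k → 0 < cR * epsOfRecord ν S.flow.g n ∧ cR * epsOfRecord ν S.flow.g n ≤ a₁ ∧ B₃ * (cR * epsOfRecord ν S.flow.g n) ≤ ν.εreg)
    (ha₀ : ν.εreg ≤ a₀) (hcomp : ∀ n, n < k → cR * epsOfRecord ν S.flow.g n ≤ 2 * (cR * epsOfRecord ν S.flow.g (n + 1)))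
    (hcomp' : ∀ n, n < k → cR * epsOfRecord ν S.flow.g (n + 1) ≤ 2 * (cR * epsOfRecord ν S.flow.g n))
    (hα : ∀ n, 1 ≤ n → n ≤ k → 0 < S.lf.alpha0 (S.flow.g n) ∧ 0 < S.lf.alpha1 (S.flow.g n))
    (hBα : ∀ n, 1 ≤ n → n ≤ k → B₃ * (cR * epsOfRecord ν S.flow.g n) ≤ (1 - S.βc) * S.lf.alpha0 (S.flow.g n))
    (hΛI0 : 0 ≤ (4 * (B₃ + (((F.P K).d - 1 : ℕ) : ℝ) * (((F.P K).L : ℝ) * M) * B₃') + 16 * ((((F.P K).d - 1 : ℕ) : ℝ) * (((F.P K).L : ℝ) * M)) ^ 2 * B₃ ^ 2 * a₁) * cR * ν.A₀)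
    (hΛI : (4 * (B₃ + (((F.P K).d - 1 : ℕ) : ℝ) * (((F.P K).L : ℝ) * M) * B₃') + 16 * ((((F.P K).d - 1 : ℕ) : ℝ) * (((F.P K).L : ℝ) * M)) ^ 2 * B₃ ^ 2 * a₁) * cR * ν.A₀ ≤
      tI * S.lf.C₀) (htI : tI < S.cB)
    (hΛMS0 : 0 ≤ (4 * (B₃ + (((F.P K).d - 1 : ℕ) : ℝ) * (M : ℝ) * B₃') + 16 * ((((F.P K).d - 1 : ℕ) : ℝ) * (M : ℝ)) ^ 2 * B₃ ^ 2 * a₁) * cR * ν.A₀)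
    (hΛMS : (4 * (B₃ + (((F.P K).d - 1 : ℕ) : ℝ) * (M : ℝ) * B₃') + 16 * ((((F.P K).d - 1 : ℕ) : ℝ) * (M : ℝ)) ^ 2 * B₃ ^ 2 * a₁) * cR * ν.A₀ ≤ tMS * S.lf.C₀)
    (htMS : tMS < S.B * S.C * S.Mr)
    (hsN : ∀ n, 1 ≤ n → n ≤ k + 1 → ((B14.Eq213MaximalDomains.side (F.P K).L M n : ℕ) : ℤ) < (F.P K).sitesPerDir 0)
    (hcB : 2 * (((F.P K).d - 1 : ℕ) : ℝ) * ((F.P K).L * M) < S.cB) (hBCM : 2 * (((F.P K).d - 1 : ℕ) : ℝ) * M < S.B * S.C * S.Mr)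
    (hsmallI : ∀ j, 1 ≤ j → j ≤ k → (((F.P K).d - 1 : ℕ) : ℝ) * ((F.P K).L * M) * (F.P K).eta j * (B₃ * (cR * epsOfRecord ν S.flow.g j)) ≤ 1 / 2)
    (hsmallMS : ∀ n, 1 ≤ n → n ≤ k → (((F.P K).d - 1 : ℕ) : ℝ) * M * (F.P K).eta n * (B₃ * (cR * epsOfRecord ν S.flow.g n)) ≤ 1 / 2)
    (hC1 : ∀ j, 1 ≤ j → j ≤ k → ∃ t : ℕ, 0 < t ∧ RkOfRecord (F.P K).L ν.r (S.flow.g j) = (F.P K).L * t)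
    (hC2 : ∀ j, 1 ≤ j → j ≤ k → dCubeSide (F.P K).L M (RkOfRecord (F.P K).L ν.r (S.flow.g j)) j ∣ (F.P K).sitesPerDir 0)
    (s : SeqOfRecord F ν M S.flow.g K k) (hsep : Sect2.SeqSeparated ν.M₁ s) (hM₁ : 0 < ν.M₁) {W : MSField (F.P K) (SU N)}
    (h7 : Sect2.DataSmall7PTop (avOfRecord F N K) s.Ω (Sup ν K s.Ω) k (fun n => cR * epsOfRecord ν S.flow.g n) W)
    {U₀ : GaugeField (F.P K) 0 (SU N)} (hmin : IsMinimizer (avOfRecord F N K)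
      {U | (∀ n, n ≤ k → PlaqSmallOn (Sect2.omegaPlaqsTop s.Ω (Sup ν K s.Ω) n) (ν.εreg * (F.P K).eta n ^ 2) U) ∧
        Sect2.CoDivClassOnTop s.Ω (Sup ν K s.Ω) k ν.εreg U} (genSet s.Ω k) W U₀) :
    ∀ j, 1 ≤ j → j ≤ k → ∀ X : (Sect2.domSys (F.P K) M j).Dom,
      (Sect2.domSites (F.P K) M j X ⊆ s.Λ j →
        Sect2.ofBackgroundC S.ι (U₀) ∈
          Sect2.spaceI S (Sect2.Residual.unit (F.P K) (MatA N)) M j (Sect2.domSites (F.P K) M j X) (S.lf.alpha0 (S.flow.g j)) (S.lf.alpha1 (S.flow.g j))) ∧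
      (Sect2.admB (F.P K) ν M S.flow.g s.Ω s.Λ j (Sect2.domSites (F.P K) M j X) = true →
        Sect2.ofBackgroundC S.ι (U₀) ∈
          Sect2.spaceMS S (Sect2.Residual.unit (F.P K) (MatA N)) M j (Sect2.domSites (F.P K) M j X) s.Ω) :=
  bgRowAtDatumU_of_thm1RegSepTop7MC1 h15 S hι h𝓜 hS hpos ν hM K k cR hB₃ hB₃' hg hpq hnum ha₀ hcomp hcomp' hα hBα hΛI0 hΛI htI hΛMS0 hΛMS htMS
    hsN hcB hBCM hsmallI hsmallMS hC1 hC2 s hsep hM₁ h7 hmin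
    (plaqC1SmallOn_of_thm1C1RegSepTop7M h15C1 ν M S.flow.g K k cR s hsep hM₁ hnum ha₀ hcomp hcomp' h7 hmin)

end SuppliersC1TopM

/-! ## §3  The C¹ sentence AT THE SUPPORT OF RECORD, the `hclassC1` supplier at `UbgMSCoPOfRecord … s 𝐖`, and the guard-free v1.5 `bg` row body -/

section AtRecordC1CoPM

variable (F : T4Family) (N : ℕ) [NeZero N]

/-- **★★ NAMED FACT, v1.5 `CoP` EDITION — [15] THEOREM 1 (9)–(10), GAUGE-INVARIANT C¹ READING (CONSEQUENCE FORM), OVER CLASS (6) ON THE SUPPORT OF RECORD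
`suppDomOfRecord`, `M₁ ≥ 1`, TWO-SIDED COMPARABILITY**: §1's `VariationalThm1C1RegSepTop7M` at the selector `Sup := suppDomOfRecord` (so its class literal is
node00-def-R's `regMSCoPOfRecord F N ν K k s.Ω` with `ε₀` for `εreg`, by `rfl`).  The citeable token of the (9)–(10) half of the v1.5 `bg` road; a `Prop` with
parameters, NEVER asserted.  HONEST LABEL and named absorptions into `B₃'`: §1 docstring (a READING of print's (9)–(10), not verbatim).  `B₃` = the (8)∕uniqueness
constant of the companion sentence `VariationalThm1RegSepCoP7M F N B₃ a₀ a₁` (print's standing range «B₃ε₁ ≤ ε₀ ≤ a₀»); floor displayed by consumers: `2L² ≤ B₃`.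
-- TODO(general form): print states (9)–(10) in an axial-type gauge on the class cubes with Hölder member `B₄(β₀)` and ONE threshold ε₁; general admissible
-- `{Ω_j}`∕`𝔅_k` ([6] Sect. A) and print's separation letter `R ≥ R₁`; orbit uniqueness is not part of this sentence.
[cite: Balaban1985Variational, (1) p.277, Thm 1 (2),(3),(5),(6),(7),(9)–(10) pp.278–279; Balaban1985RegularSpaces, (1.3)–(1.9) p.77; Balaban1988Convergent, p.255, (2.6)–(2.8) pp.255–256, (2.12) p.256, (2.38) p.261] -/
def VariationalThm1C1RegSepCoP7M (B₃ B₃' a₀ a₁ : ℝ) : Prop :=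
  VariationalThm1C1RegSepTop7M F N (fun ν K Ω => suppDomOfRecord F ν K Ω) B₃ B₃' a₀ a₁

variable {F N}

/-- Definitional bridge to the C¹ top-domain sentence at the selector of record. [cite: Balaban1985Variational, Thm 1 (9)–(10) p.279 (bookkeeping)] -/
theorem VariationalThm1C1RegSepCoP7M.toTop7M {B₃ B₃' a₀ a₁ : ℝ} (h : VariationalThm1C1RegSepCoP7M F N B₃ B₃' a₀ a₁) :
    VariationalThm1C1RegSepTop7M F N (fun ν K Ω => suppDomOfRecord F ν K Ω) B₃ B₃' a₀ a₁ := h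

/-- Conversely (definitional). [cite: Balaban1985Variational, Thm 1 (9)–(10) p.279 (bookkeeping)] -/
theorem VariationalThm1C1RegSepTop7M.toCoP7M {B₃ B₃' a₀ a₁ : ℝ} (h : VariationalThm1C1RegSepTop7M F N (fun ν K Ω => suppDomOfRecord F ν K Ω) B₃ B₃' a₀ a₁) :
    VariationalThm1C1RegSepCoP7M F N B₃ B₃' a₀ a₁ := h

/-- The C¹ `CoP` sentence is ANTITONE in `a₀`, `a₁`. [cite: Balaban1985Variational, Thm 1 p.279 (the range «ε₀ ≤ a₀», «ε₁ ≤ a₁»)] -/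
theorem VariationalThm1C1RegSepCoP7M.of_le {B₃ B₃' a₀ a₀' a₁ a₁' : ℝ} (h : VariationalThm1C1RegSepCoP7M F N B₃ B₃' a₀ a₁) (ha₀ : a₀' ≤ a₀) (ha₁ : a₁' ≤ a₁) :
    VariationalThm1C1RegSepCoP7M F N B₃ B₃' a₀' a₁' :=
  VariationalThm1C1RegSepTop7M.of_le h ha₀ ha₁

/-- The C¹ `CoP` sentence is MONOTONE in the C¹ constant `B₃'`. [cite: Balaban1985Variational, Thm 1 (9)–(10) p.279 (bookkeeping)] -/
theorem VariationalThm1C1RegSepCoP7M.mono {B₃ B₃' B₃'' a₀ a₁ : ℝ} (h : VariationalThm1C1RegSepCoP7M F N B₃ B₃' a₀ a₁) (hB : B₃' ≤ B₃'') :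
    VariationalThm1C1RegSepCoP7M F N B₃ B₃'' a₀ a₁ :=
  VariationalThm1C1RegSepTop7M.mono h hB

/-- **★ def-R's COLLAR-CLASS BACKGROUND `UbgMSCoPOfRecord … s 𝐖` MEETS THE C¹ CLASS BOUND `B₃'·cR·ε_n·η_n³` ON THE PLAQUETTE PAIRS INSIDE `Ω_n`, `1 ≤ n ≤ k`, ON THE
SOLVABLE SET** — LITERALLY FILE 12d ★★★'s displayed clause `hclassC1`, now supplied from the C¹ `CoP` sentence (`0 < M₁`), for a separated sequence, thresholds
comparable both ways and a datum with print's (7) on the support (`h7`). [cite: Balaban1985Variational, Thm 1 (2),(6),(7),(9)–(10) pp.278–279; Balaban1985RegularSpaces, (1.3) p.77; Balaban1988Convergent, (2.6)–(2.8) pp.255–256, (2.12) p.256] -/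
theorem plaqC1SmallOn_UbgMSCoPOfRecord_of_thm1C1RegSepCoP7M {B₃ B₃' a₀ a₁ : ℝ} (h15C1 : VariationalThm1C1RegSepCoP7M F N B₃ B₃' a₀ a₁) (ν : Stage7Numerics) (M : ℕ)
    (g : ℕ → ℝ) (K k : ℕ) (cR : ℝ) (s : SeqOfRecord F ν M g K k) (hsep : Sect2.SeqSeparated ν.M₁ s) (hM₁ : 0 < ν.M₁)
    (hnum : ∀ n, n ≤ k → 0 < cR * epsOfRecord ν g n ∧ cR * epsOfRecord ν g n ≤ a₁ ∧ B₃ * (cR * epsOfRecord ν g n) ≤ ν.εreg) (ha₀ : ν.εreg ≤ a₀)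
    (hcomp : ∀ n, n < k → cR * epsOfRecord ν g n ≤ 2 * (cR * epsOfRecord ν g (n + 1)))
    (hcomp' : ∀ n, n < k → cR * epsOfRecord ν g (n + 1) ≤ 2 * (cR * epsOfRecord ν g n))
    {W : MSField (F.P K) (SU N)} (h7 : Sect2.DataSmall7PTop (avOfRecord F N K) s.Ω (suppDomOfRecord F ν K s.Ω) k (fun n => cR * epsOfRecord ν g n) W)
    (hsol : W ∈ solvableDom (avOfRecord F N K) (regMSCoPOfRecord F N ν K k s.Ω) (genSet s.Ω k)) :
    ∀ n, 1 ≤ n → n ≤ k →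
      PlaqC1SmallOn (plaqInside (s.Ω n)) (B₃' * (cR * epsOfRecord ν g n) * (F.P K).eta n ^ 3) (UbgMSCoPOfRecord F N ν M g K k s W) :=
  plaqC1SmallOn_of_thm1C1RegSepTop7M h15C1 ν M g K k cR s hsep hM₁ hnum ha₀ hcomp hcomp' h7 (isMinimizer_UbgMSCoPOfRecord ν M g K k s hsol)

/-- **★★★ ROW P11's BODY AT `(s, 𝐖)` FOR def-R's COLLAR-CLASS MINIMISER `UbgMSCoPOfRecord … s 𝐖`, FROM THE TWO CITED [15] SENTENCES — (8) `VariationalThm1RegSepCoP7M`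
AND (9)–(10) `VariationalThm1C1RegSepCoP7M` — WITH NO DISPLAYED C¹ GUARD**: FILE 12d's ★★★ `bgRowAtDatumCoP_of_thm1RegSepCoP7MC1` binder for binder, its hypothesis
`hclassC1` DISCHARGED by `plaqC1SmallOn_UbgMSCoPOfRecord_of_thm1C1RegSepCoP7M` (on the solvable set; off it 12d's junk `1` via `bgRowAtDatum_one`).  Hypotheses:
the two sentences, print's (7) on the datum over the support (`h7`), the numerics∕letters of 12d's ★★★, `hcomp` AND `hcomp'`, `hM₁` — NO `h9`, NO `hclassC1`.
The v1.5 `Record13SepCoP` `bg` row's supplier for a consumer that cites BOTH sentences (node00-def-K0a's optional one-token re-key of 16c).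
[cite: Balaban1985Variational, Thm 1 (2),(6)–(10) pp.278–279; Balaban1988Convergent, p.255, (2.6)–(2.8) pp.255–256, (2.12) p.256, (2.27)–(2.28) p.259, (2.34)–(2.41) p.261; Balaban1987RG1, (1.11)–(1.16) p.262] -/
theorem bgRowAtDatumCoP_of_thm1RegSepCoP7M_of_thm1C1 {B₃ B₃' a₀ a₁ tI tMS : ℝ}
    (h15 : VariationalThm1RegSepCoP7M F N B₃ a₀ a₁) (h15C1 : VariationalThm1C1RegSepCoP7M F N B₃ B₃' a₀ a₁)
    (S : Sect2.Setting (MatA N) (SU N)) (hι : S.ι = ιSU N) (h𝓜 : S.𝓜 = B12RegularSpaces111SpecialUnitary.suModel N) (hS : S.Laws) (hpos : S.Pos)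
    (ν : Stage7Numerics) {M : ℕ} (hM : 0 < M) (K k : ℕ) (cR : ℝ) (hB₃ : 0 ≤ B₃) (hB₃' : 0 ≤ B₃')
    (hg : ∀ j, 1 ≤ j → j ≤ k → 0 < S.flow.g j ∧ S.flow.g j ^ 2 ≤ Real.exp (-1)) (hpq : ν.p₀ ≤ S.lf.q₀)
    (hnum : ∀ n, n ≤ k → 0 < cR * epsOfRecord ν S.flow.g n ∧ cR * epsOfRecord ν S.flow.g n ≤ a₁ ∧ B₃ * (cR * epsOfRecord ν S.flow.g n) ≤ ν.εreg)
    (ha₀ : ν.εreg ≤ a₀) (hcomp : ∀ n, n < k → cR * epsOfRecord ν S.flow.g n ≤ 2 * (cR * epsOfRecord ν S.flow.g (n + 1)))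
    (hcomp' : ∀ n, n < k → cR * epsOfRecord ν S.flow.g (n + 1) ≤ 2 * (cR * epsOfRecord ν S.flow.g n))
    (hα : ∀ n, 1 ≤ n → n ≤ k → 0 < S.lf.alpha0 (S.flow.g n) ∧ 0 < S.lf.alpha1 (S.flow.g n))
    (hBα : ∀ n, 1 ≤ n → n ≤ k → B₃ * (cR * epsOfRecord ν S.flow.g n) ≤ (1 - S.βc) * S.lf.alpha0 (S.flow.g n))
    (hΛI0 : 0 ≤ (4 * (B₃ + (((F.P K).d - 1 : ℕ) : ℝ) * (((F.P K).L : ℝ) * M) * B₃') + 16 * ((((F.P K).d - 1 : ℕ) : ℝ) * (((F.P K).L : ℝ) * M)) ^ 2 * B₃ ^ 2 * a₁) * cR * ν.A₀)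
    (hΛI : (4 * (B₃ + (((F.P K).d - 1 : ℕ) : ℝ) * (((F.P K).L : ℝ) * M) * B₃') + 16 * ((((F.P K).d - 1 : ℕ) : ℝ) * (((F.P K).L : ℝ) * M)) ^ 2 * B₃ ^ 2 * a₁) * cR * ν.A₀ ≤
      tI * S.lf.C₀) (htI : tI < S.cB)
    (hΛMS0 : 0 ≤ (4 * (B₃ + (((F.P K).d - 1 : ℕ) : ℝ) * (M : ℝ) * B₃') + 16 * ((((F.P K).d - 1 : ℕ) : ℝ) * (M : ℝ)) ^ 2 * B₃ ^ 2 * a₁) * cR * ν.A₀)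
    (hΛMS : (4 * (B₃ + (((F.P K).d - 1 : ℕ) : ℝ) * (M : ℝ) * B₃') + 16 * ((((F.P K).d - 1 : ℕ) : ℝ) * (M : ℝ)) ^ 2 * B₃ ^ 2 * a₁) * cR * ν.A₀ ≤ tMS * S.lf.C₀)
    (htMS : tMS < S.B * S.C * S.Mr)
    (hsN : ∀ n, 1 ≤ n → n ≤ k + 1 → ((B14.Eq213MaximalDomains.side (F.P K).L M n : ℕ) : ℤ) < (F.P K).sitesPerDir 0)
    (hcB : 2 * (((F.P K).d - 1 : ℕ) : ℝ) * ((F.P K).L * M) < S.cB) (hBCM : 2 * (((F.P K).d - 1 : ℕ) : ℝ) * M < S.B * S.C * S.Mr)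
    (hsmallI : ∀ j, 1 ≤ j → j ≤ k → (((F.P K).d - 1 : ℕ) : ℝ) * ((F.P K).L * M) * (F.P K).eta j * (B₃ * (cR * epsOfRecord ν S.flow.g j)) ≤ 1 / 2)
    (hsmallMS : ∀ n, 1 ≤ n → n ≤ k → (((F.P K).d - 1 : ℕ) : ℝ) * M * (F.P K).eta n * (B₃ * (cR * epsOfRecord ν S.flow.g n)) ≤ 1 / 2)
    (hC1 : ∀ j, 1 ≤ j → j ≤ k → ∃ t : ℕ, 0 < t ∧ RkOfRecord (F.P K).L ν.r (S.flow.g j) = (F.P K).L * t)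
    (hC2 : ∀ j, 1 ≤ j → j ≤ k → dCubeSide (F.P K).L M (RkOfRecord (F.P K).L ν.r (S.flow.g j)) j ∣ (F.P K).sitesPerDir 0)
    (s : SeqOfRecord F ν M S.flow.g K k) (hsep : Sect2.SeqSeparated ν.M₁ s) (hM₁ : 0 < ν.M₁) (W : MSField (F.P K) (SU N))
    (h7 : Sect2.DataSmall7PTop (avOfRecord F N K) s.Ω (suppDomOfRecord F ν K s.Ω) k (fun n => cR * epsOfRecord ν S.flow.g n) W) :
    ∀ j, 1 ≤ j → j ≤ k → ∀ X : (Sect2.domSys (F.P K) M j).Dom,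
      (Sect2.domSites (F.P K) M j X ⊆ s.Λ j →
        Sect2.ofBackgroundC S.ι (UbgMSCoPOfRecord F N ν M S.flow.g K k s W) ∈
          Sect2.spaceI S (Sect2.Residual.unit (F.P K) (MatA N)) M j (Sect2.domSites (F.P K) M j X) (S.lf.alpha0 (S.flow.g j)) (S.lf.alpha1 (S.flow.g j))) ∧
      (Sect2.admB (F.P K) ν M S.flow.g s.Ω s.Λ j (Sect2.domSites (F.P K) M j X) = true →
        Sect2.ofBackgroundC S.ι (UbgMSCoPOfRecord F N ν M S.flow.g K k s W) ∈
          Sect2.spaceMS S (Sect2.Residual.unit (F.P K) (MatA N)) M j (Sect2.domSites (F.P K) M j X) s.Ω) :=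
  bgRowAtDatumCoP_of_thm1RegSepCoP7MC1 h15 S hι h𝓜 hS hpos ν hM K k cR hB₃ hB₃' hg hpq hnum ha₀ hcomp hcomp' hα hBα hΛI0 hΛI htI hΛMS0 hΛMS htMS
    hsN hcB hBCM hsmallI hsmallMS hC1 hC2 s hsep hM₁ W h7
    (fun hsol => plaqC1SmallOn_UbgMSCoPOfRecord_of_thm1C1RegSepCoP7M h15C1 ν M S.flow.g K k cR s hsep hM₁ hnum ha₀ hcomp hcomp' h7 hsol)


end AtRecordC1CoPM

end Literature.MathematicalPhysics.QuantumFieldTheory.Balaban1983to89.Node00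

end
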